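import Summits.NavierStokesRegularity.TurbBounds.ShearCutoff
import Summits.NavierStokesRegularity.TurbBounds.Certs.C200.Scalars

/-!
# Certificate C200 (CERTIFIED.md row R-C200 = gate G1: plane Couette, RZG25 formulation, Re 200, Γ_y = 2π) — every mode beyond the cutoff is free

The scalar line `Certs.C200.Scalars.cutoff : T ≤ c·(m_cert + 1)²` (T = ‖ĝ‖₁ ≥ ‖g‖_∞, c = a − 1 > 0, m_cert = 22; spanwise
wavenumber k = m exactly at Γ_y = 2π) fed into `ShearCutoff.couette_modes_free_nat`: every spanwise mode `k ≥ 23` has `T ≤ c·k²`,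
the hypothesis of `ShearCutoff.couette_mode_free` (lemma R-SC at the integral level) — so only k = 1 … 22 need LMI blocks
(`Certs.C200.B001 … B022`); by `ShearCutoff.couette_oblique_free` the same holds for every oblique wavevector with K ≥ k², k ≥ 23
(the oblique wavevectors with K below the cutoff are NOT certified — label '2.5-D spectral constraint', CERT-SHEAR §3).
Pure instance file (pub-turb-shear gen 5). HONEST FRAMING: rigorous bounds for the stated PDE and boundary conditions; no claim
about physical turbulence beyond the bound.
-/

namespace Summit.NavierStokesRegularity.TurbBounds.Certs.C200

/-- **R-C200: all spanwise modes `k ≥ m_cert + 1 = 23` are free** (`‖ĝ‖₁ ≤ c·k²`, the hypothesis of `ShearCutoff.couette_mode_free`). -/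
theorem modes_free {k : ℕ} (hk : Scalars.mCert + 1 ≤ k) : (Scalars.T : ℝ) ≤ (Scalars.c : ℝ) * (k : ℝ) ^ 2 := by
  have h : (Scalars.T : ℝ) ≤ (Scalars.c : ℝ) * ((Scalars.mCert : ℝ) + 1) ^ 2 := by exact_mod_cast Scalars.cutoff
  have hc : (0 : ℝ) ≤ (Scalars.c : ℝ) := by exact_mod_cast Scalars.c_pos.le
  exact ShearCutoff.couette_modes_free_nat hc h hk

/-- In particular the first free spanwise mode is `k = 23`. -/
example : (Scalars.T : ℝ) ≤ (Scalars.c : ℝ) * ((23 : ℕ) : ℝ) ^ 2 := modes_free (by decide)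

end Summit.NavierStokesRegularity.TurbBounds.Certs.C200
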